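import Summits.BirchSwinnertonDyer.BirchSwinnertonDyer.Theorems.ByReductionTypeAtTwoTowerLayerGap
import Literature.NumberTheory.EllipticCurves.Greenberg1999.ControlLocalKernelsLayer
import HarnessLib

/-!
# The TOWER doors with EVERY local error term read from PRINT (Greenberg LNM 1716 Lemmas 3.3, 3.4 at
# the layers) + per-curve certificates (route ByReductionTypeAtTwo, crux `OrdKatoHalfAtTwo`, item
# stmt-BirchSwinnertonDyer-19271; seat bsd-2adic-tower-1, D-0074 (T1), part 4)

HONEST FRAMING (cell `bsd-2adic`, run/shared/lean/pub/bsd-2adic/, HUMAN RULINGS D-0036/D-0074): THEOREMS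
ONLY; nothing asserted; no definition; no new named fact; closes nothing by itself. BSD is NOT proved by
any of this: a discharge closes a rung leaf of the `2`-adic class list, modulo the PUBLISHED inputs named
below (taken as hypotheses BY NAME) and per-curve CERTIFICATES (computations, evidence-carried).

Part 3b (`…TowerLayerGap.lean`) left the level-`j'` local kernel inputs (h0)/(hC)/(hN) as kernel-object
hypotheses. Here they are DISCHARGED from:
* PRINT (named facts of `Literature/…/Greenberg1999/ControlLocalKernelsLayer.lean`, binders `h33g`,
  `h33`, `h34`): Greenberg LNM 1716 Lemma 3.3 (good odd `v`: `𝒦_{v,n}[2^∞] = 0`; any odd `v`: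
  `#𝒦_{v,n}[2^∞] ≤ #B_v/(B_v)_div`, LEVEL-INDEPENDENT) and Lemma 3.4 for `ℚ` (`v = 2`, good ordinary:
  `#𝒦_{v,n}[2^∞] = |Ẽ(𝔽₂)_2|²`);
* the PROVED covers of part 3a (`N_2 = 1`: `2` is totally ramified; `N_v ≤ 2^{j'}` at odd `v`);
* CERTIFICATES: `β_v ≥ #B_v/(B_v)_div` at the odd bad primes `v ∈ S` (per Greenberg p. 88 the value is
  the `2`-part of a Tamagawa factor; `B_v = E(K̄_v)^{H_{v,∞}}[2^∞]` is a finite-layer-free local object),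
  the layer Selmer counts, `#Ẽ(𝔽₂)` (`reductionPointCount W 2 ∈ {2, 4}` at good ordinary `2`), and the
  arithmetic inequality.

* `towerGapAtTwo_of_layerSelmer_of_greenberg` — `O1.TowerGapAtTwo W` from {`h33g`, `h33`, `h34`} +
  certificates {`2^a ≤ #Sel_{2^∞}(E/ℚ_j)[2]`, `#Sel_{2^∞}(E/ℚ_{j'})[2] ≤ 2^d`, `β`, arithmetic
  `2^d · |Ẽ(𝔽₂)_2|² · ∏_{v ∈ S odd} β_v^{2^{j'}} < 2^{2^{j'} − 2^j + a}`} on a good-ordinary-at-`2` curve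
  with odd torsion order, `S ⊇` {`2`, bad primes}.
* `bsdp_two_of_layerSelmer_of_greenberg` (rank `0`), `mazurMainConjecture_two_of_layerSelmer_of_greenberg`,
  `katoHalfAt_two_of_layerSelmer_of_greenberg` (the item AT `W`): PRINT {modularity, GZK, Kato 17.4
  (1)(2)@2 (`h17`), Greenberg Thm. 4.1@2 (`hEC`, rank `0` only), Prop. 4.14@2 (`h414`), Lemma 3.3@2
  (`h33g`, `h33`), Lemma 3.4@2 (`h34`)} + CERTIFICATES {`hper₀`, `μ_an = 0`, `λ_an = n`,
  `2^n ≤ #Sel_{2^∞}(E/ℚ_{j₀})[2]`, `2^a ≤ #Sel_{2^∞}(E/ℚ_j)[2]`, `#Sel_{2^∞}(E/ℚ_{j'})[2] ≤ 2^d`, `β_v`,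
  arithmetic}. The exponent `2^{j'}` at the odd bad primes is the CRUDE cover (a sharp one would use the
  number of primes of `ℚ_{j'}` above `v`); it is harmless exactly when `β_v = 1`.

References: R. Greenberg, LNM 1716 (1999), §3 Lemmas 3.3–3.5 (PDF pp. 86–90), Thm. 4.1, Prop. 4.14;
K. Kato, Astérisque 295 (2004), Thm. 17.4; L. Washington, *Introduction to Cyclotomic Fields*, §13.
-/

set_option autoImplicit false

noncomputable section

open scoped Classical MatrixGroups ModularForm

open NumberField IsDedekindDomain CongruenceSubgroup WeierstrassCurve Literature.NumberTheory.EllipticCurves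
  Literature.NumberTheory.EllipticCurves.ModularForms Literature.NumberTheory.EllipticCurves.Rank1Residual
  Literature.NumberTheory.EllipticCurves.Rank1Residual.Typed
  Literature.NumberTheory.EllipticCurves.Greenberg1999
  Summit.BirchSwinnertonDyer.Rank1Residual.X1.MuLambda
  Summit.BirchSwinnertonDyer.Rank1Residual.X1.MuPart
  Summit.BirchSwinnertonDyer.Rank1Residual.X1.ParitySqueeze
  Summit.BirchSwinnertonDyer.BirchSwinnertonDyer.Theorems.Rank1ResidualX1Defs
  Summit.BirchSwinnertonDyer.Rank1Residual.X5 Summit.BirchSwinnertonDyer.Rank1Residual.X5.O1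
  Summit.BirchSwinnertonDyer.Rank1Residual.X5.TowerGap
  Summit.BirchSwinnertonDyer.Rank1Residual

namespace Summit.BirchSwinnertonDyer.BirchSwinnertonDyer.Theorems.KatoHalfPinch

section Curve

variable (W : WeierstrassCurve ℚ) [W.IsElliptic] [W.IsGloballyMinimal]

/-- **The GAP certificate with every local error term from PRINT + certificates.** `W/ℚ` good ordinary
at `2` with odd torsion order; layers `j ≤ j'`; `S` a finite set of places off which every place is odd
and of good reduction (`hS`); PRINT: Greenberg Lemma 3.3 (both parts, at every layer) and Lemma 3.4 for
`ℚ` as named-fact binders; certificates: `2^a ≤ #Sel_{2^∞}(E/ℚ_j)[2]`, `#Sel_{2^∞}(E/ℚ_{j'})[2] ≤ 2^d`,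
`#B_v/(B_v)_div ≤ β_v` at the odd `v ∈ S`, and
`2^d · ∏_{v ∈ S} (2 ∈ v ? |Ẽ(𝔽₂)_2|² : β_v^{2^{j'}}) < 2^{2^{j'} − 2^j + a}`. Then `O1.TowerGapAtTwo W`
(part 3b with `C_v = |Ẽ(𝔽₂)_2|²`, `N_v = 1` at `2`; `C_v = β_v`, `N_v = 2^{j'}` at odd `v`).
[cite: GreenbergLNM1716, §3 Lemmas 3.3, 3.4, 3.5 (PDF pp. 86–90)] [cite: Washington1997, §13.2] -/
theorem towerGapAtTwo_of_layerSelmer_of_greenberg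
    (h33g : lemma33_localTowerKerPrimary_eq_bot_of_good.{0})
    (h33 : lemma33_natCard_localTowerKerPrimary_le.{0})
    (h34 : lemma34_natCard_localTowerKerPrimary_eq_rat)
    (hgo : GoodOrd W 2) (htors : ¬ 2 ∣ W.torsionOrder) {j j' a d : ℕ} (hjj' : j ≤ j')
    (S : Finset (HeightOneSpectrum (𝓞 ℚ)))
    (hS : ∀ v ∉ S, ((2 : ℕ) : 𝓞 ℚ) ∉ v.asIdeal ∧ W.HasGoodReductionAt v)
    (β : HeightOneSpectrum (𝓞 ℚ) → ℕ)
    (hβ : ∀ κ : ZpExtension ℚ 2, κ.IsCyclotomic → ∀ v ∈ S, ((2 : ℕ) : 𝓞 ℚ) ∉ v.asIdeal →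
      Nat.card (↥(W.localTopPrimary κ (v.adicCompletion ℚ)) ⧸
        W.localTopPrimaryDiv κ (v.adicCompletion ℚ)) ≤ β v)
    (hlow : ∀ κ : ZpExtension ℚ 2, κ.IsCyclotomic →
      2 ^ a ≤ Nat.card {z : W.selmerLayer κ j // 2 • z = 0})
    (hup : ∀ κ : ZpExtension ℚ 2, κ.IsCyclotomic →
      Nat.card {z : W.selmerLayer κ j' // 2 • z = 0} ≤ 2 ^ d)
    (harith : 2 ^ d * ∏ v ∈ S,
        (if ((2 : ℕ) : 𝓞 ℚ) ∈ v.asIdeal then (2 ^ padicValNat 2 (W.reductionPointCount 2)) ^ 2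
          else β v) ^ (if ((2 : ℕ) : 𝓞 ℚ) ∈ v.asIdeal then 1 else 2 ^ j') <
      2 ^ (2 ^ j' - 2 ^ j + a)) : TowerGapAtTwo W := by
  refine towerGapAtTwo_of_localKernelBounds W htors hjj' S
    (fun v ↦ if ((2 : ℕ) : 𝓞 ℚ) ∈ v.asIdeal then (2 ^ padicValNat 2 (W.reductionPointCount 2)) ^ 2
      else β v)
    (fun v ↦ if ((2 : ℕ) : 𝓞 ℚ) ∈ v.asIdeal then 1 else 2 ^ j') hlow hup
    (fun κ hκ v hv ↦ h33g ℚ W 2 κ hκ v (hS v hv).1 (hS v hv).2 j') (fun κ hκ v hv ↦ ?_)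
    (fun κ hκ v hv ↦ ?_) harith
  · by_cases h2 : ((2 : ℕ) : 𝓞 ℚ) ∈ v.asIdeal
    · rw [if_pos h2]
      exact pTorsion_le_of_lemma34 h34 W 2 hgo κ hκ v h2 j'
    · rw [if_neg h2]
      obtain ⟨hfin, hle⟩ := pTorsion_le_of_lemma33 h33 W 2 κ hκ v h2 j'
      exact ⟨hfin, hle.trans (hβ κ hκ v hv h2)⟩
  · by_cases h2 : ((2 : ℕ) : 𝓞 ℚ) ∈ v.asIdeal
    · refine ⟨{1}, by rw [if_pos h2, Finset.card_singleton], ?_⟩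
      exact TowerLayer.cover_singleton_at_p κ hκ v h2 j'
    · obtain ⟨R, hR, hcov⟩ := TowerLayer.exists_cover_of_layerSubgroup κ (v.adicCompletion ℚ) j'
      exact ⟨R, by rw [if_neg h2, hR], hcov⟩

/-- **Door (TOWER; every local term from PRINT + certificates) for `BSD(E,2)` at analytic rank `0`**
on a good-ordinary-at-`2` curve with odd torsion order: PRINT {modularity, GZK, Kato 17.4 (1)(2)@2,
Greenberg Thm. 4.1@2, Prop. 4.14@2, Lemma 3.3@2 (both parts, every layer), Lemma 3.4@2 (`ℚ`, every
layer)} + CERTIFICATES {`hper₀`, `μ_an = 0`, `λ_an = n`, `2^n ≤ #Sel_{2^∞}(E/ℚ_{j₀})[2]`,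
`2^a ≤ #Sel_{2^∞}(E/ℚ_j)[2]`, `#Sel_{2^∞}(E/ℚ_{j'})[2] ≤ 2^d`, `β_v`, arithmetic} ⇒ `BSDp W 2`.
[cite: GreenbergLNM1716, Thm. 4.1, Prop. 4.14, §3 Lemmas 3.3–3.5] [cite: Kato2004Asterisque, Thm. 17.4 (1)(2) (p. 273)]
[cite: Miller2011LMS, Def. 1.1] -/
theorem bsdp_two_of_layerSelmer_of_greenberg (hmod : nonempty_modularParametrizationData)
    (hGZK : rank_eq_analyticRank_of_analyticRank_le_one)
    (h17 : ∀ [NeZero (W.conductorNorm ℤ)] (f : CuspForm (Gamma0 (W.conductorNorm ℤ)) 2),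
      kato_divisibility_allPrimes W 2 (f := f))
    (hEC : TwoAdicEulerCharRankZero W 0) (h414 : prop414_noFiniteSubmodule_of_not_dvd_torsionOrder)
    (h33g : lemma33_localTowerKerPrimary_eq_bot_of_good.{0})
    (h33 : lemma33_natCard_localTowerKerPrimary_le.{0})
    (h34 : lemma34_natCard_localTowerKerPrimary_eq_rat)
    (hper₀ : ∀ [NeZero (W.conductorNorm ℤ)] (f : CuspForm (Gamma0 (W.conductorNorm ℤ)) 2),
      IsNewformOf W f → ∀ ϖ : ℚ, (ϖ : ℝ) * W.realPeriodRat = plusPeriod f → 0 ≤ padicValRat 2 ϖ)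
    (hgo : GoodOrd W 2) (hr : W.analyticRank = 0) (htors : ¬ 2 ∣ W.torsionOrder) {n j₀ j j' a d : ℕ}
    (hrank : ∀ κ : ZpExtension ℚ 2, κ.IsCyclotomic →
      2 ^ n ≤ Nat.card {z : W.selmerLayer κ j₀ // 2 • z = 0})
    (hjj' : j ≤ j') (S : Finset (HeightOneSpectrum (𝓞 ℚ)))
    (hS : ∀ v ∉ S, ((2 : ℕ) : 𝓞 ℚ) ∉ v.asIdeal ∧ W.HasGoodReductionAt v)
    (β : HeightOneSpectrum (𝓞 ℚ) → ℕ)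
    (hβ : ∀ κ : ZpExtension ℚ 2, κ.IsCyclotomic → ∀ v ∈ S, ((2 : ℕ) : 𝓞 ℚ) ∉ v.asIdeal →
      Nat.card (↥(W.localTopPrimary κ (v.adicCompletion ℚ)) ⧸
        W.localTopPrimaryDiv κ (v.adicCompletion ℚ)) ≤ β v)
    (hlow : ∀ κ : ZpExtension ℚ 2, κ.IsCyclotomic →
      2 ^ a ≤ Nat.card {z : W.selmerLayer κ j // 2 • z = 0})
    (hup : ∀ κ : ZpExtension ℚ 2, κ.IsCyclotomic →
      Nat.card {z : W.selmerLayer κ j' // 2 • z = 0} ≤ 2 ^ d)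
    (harith : 2 ^ d * ∏ v ∈ S,
        (if ((2 : ℕ) : 𝓞 ℚ) ∈ v.asIdeal then (2 ^ padicValNat 2 (W.reductionPointCount 2)) ^ 2
          else β v) ^ (if ((2 : ℕ) : 𝓞 ℚ) ∈ v.asIdeal then 1 else 2 ^ j') <
      2 ^ (2 ^ j' - 2 ^ j + a))
    (hlan : AnalyticLambdaEq W 2 n) (hμan : AnalyticMuLE W 2 0) : BSDp W 2 :=
  bsdp_two_of_towerGap_of_layerSelmer W hmod hGZK h17 hEC h414 hper₀ hgo hr htors
    (towerGapAtTwo_of_layerSelmer_of_greenberg W h33g h33 h34 hgo htors hjj' S hS β hβ hlow hup harith)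
    hrank hlan hμan

/-- **Door (TOWER; every local term from PRINT + certificates): `MazurMainConjecture W 2`** — any
analytic rank, any residual image, odd torsion order. [cite: Kato2004Asterisque, Thm. 17.4 (1)(2) (p. 273)]
[cite: GreenbergLNM1716, Prop. 4.14, §3 Lemmas 3.3–3.5] [cite: GreenbergVatsal2000, p. 4 (after Thm. (1.2))] -/
theorem mazurMainConjecture_two_of_layerSelmer_of_greenberg
    (h17 : ∀ [NeZero (W.conductorNorm ℤ)] (f : CuspForm (Gamma0 (W.conductorNorm ℤ)) 2),
      kato_divisibility_allPrimes W 2 (f := f))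
    (h414 : prop414_noFiniteSubmodule_of_not_dvd_torsionOrder)
    (h33g : lemma33_localTowerKerPrimary_eq_bot_of_good.{0})
    (h33 : lemma33_natCard_localTowerKerPrimary_le.{0})
    (h34 : lemma34_natCard_localTowerKerPrimary_eq_rat)
    (hper₀ : ∀ [NeZero (W.conductorNorm ℤ)] (f : CuspForm (Gamma0 (W.conductorNorm ℤ)) 2),
      IsNewformOf W f → ∀ ϖ : ℚ, (ϖ : ℝ) * W.realPeriodRat = plusPeriod f → 0 ≤ padicValRat 2 ϖ)
    (hgo : GoodOrd W 2) (htors : ¬ 2 ∣ W.torsionOrder) {n j₀ j j' a d : ℕ}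
    (hrank : ∀ κ : ZpExtension ℚ 2, κ.IsCyclotomic →
      2 ^ n ≤ Nat.card {z : W.selmerLayer κ j₀ // 2 • z = 0})
    (hjj' : j ≤ j') (S : Finset (HeightOneSpectrum (𝓞 ℚ)))
    (hS : ∀ v ∉ S, ((2 : ℕ) : 𝓞 ℚ) ∉ v.asIdeal ∧ W.HasGoodReductionAt v)
    (β : HeightOneSpectrum (𝓞 ℚ) → ℕ)
    (hβ : ∀ κ : ZpExtension ℚ 2, κ.IsCyclotomic → ∀ v ∈ S, ((2 : ℕ) : 𝓞 ℚ) ∉ v.asIdeal →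
      Nat.card (↥(W.localTopPrimary κ (v.adicCompletion ℚ)) ⧸
        W.localTopPrimaryDiv κ (v.adicCompletion ℚ)) ≤ β v)
    (hlow : ∀ κ : ZpExtension ℚ 2, κ.IsCyclotomic →
      2 ^ a ≤ Nat.card {z : W.selmerLayer κ j // 2 • z = 0})
    (hup : ∀ κ : ZpExtension ℚ 2, κ.IsCyclotomic →
      Nat.card {z : W.selmerLayer κ j' // 2 • z = 0} ≤ 2 ^ d)
    (harith : 2 ^ d * ∏ v ∈ S,
        (if ((2 : ℕ) : 𝓞 ℚ) ∈ v.asIdeal then (2 ^ padicValNat 2 (W.reductionPointCount 2)) ^ 2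
          else β v) ^ (if ((2 : ℕ) : 𝓞 ℚ) ∈ v.asIdeal then 1 else 2 ^ j') <
      2 ^ (2 ^ j' - 2 ^ j + a))
    (hlan : AnalyticLambdaEq W 2 n) (hμan : AnalyticMuLE W 2 0) : MazurMainConjecture W 2 :=
  mazurMainConjecture_two_of_towerGap_of_layerSelmer W h17 h414 hper₀ hgo htors
    (towerGapAtTwo_of_layerSelmer_of_greenberg W h33g h33 h34 hgo htors hjj' S hS β hβ hlow hup harith)
    hrank hlan hμan

/-- **The Kato–Néron half (the item `OrdKatoHalfAtTwo` AT `W`); every local term from PRINT +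
certificates.** [cite: Kato2004Asterisque, Thm. 17.4 (1)(2) (p. 273)]
[cite: GreenbergLNM1716, Prop. 4.14, §3 Lemmas 3.3–3.5] -/
theorem katoHalfAt_two_of_layerSelmer_of_greenberg
    (h17 : ∀ [NeZero (W.conductorNorm ℤ)] (f : CuspForm (Gamma0 (W.conductorNorm ℤ)) 2),
      kato_divisibility_allPrimes W 2 (f := f))
    (h414 : prop414_noFiniteSubmodule_of_not_dvd_torsionOrder)
    (h33g : lemma33_localTowerKerPrimary_eq_bot_of_good.{0})
    (h33 : lemma33_natCard_localTowerKerPrimary_le.{0})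
    (h34 : lemma34_natCard_localTowerKerPrimary_eq_rat)
    (hper₀ : ∀ [NeZero (W.conductorNorm ℤ)] (f : CuspForm (Gamma0 (W.conductorNorm ℤ)) 2),
      IsNewformOf W f → ∀ ϖ : ℚ, (ϖ : ℝ) * W.realPeriodRat = plusPeriod f → 0 ≤ padicValRat 2 ϖ)
    (hgo : GoodOrd W 2) (htors : ¬ 2 ∣ W.torsionOrder) {n j₀ j j' a d : ℕ}
    (hrank : ∀ κ : ZpExtension ℚ 2, κ.IsCyclotomic →
      2 ^ n ≤ Nat.card {z : W.selmerLayer κ j₀ // 2 • z = 0})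
    (hjj' : j ≤ j') (S : Finset (HeightOneSpectrum (𝓞 ℚ)))
    (hS : ∀ v ∉ S, ((2 : ℕ) : 𝓞 ℚ) ∉ v.asIdeal ∧ W.HasGoodReductionAt v)
    (β : HeightOneSpectrum (𝓞 ℚ) → ℕ)
    (hβ : ∀ κ : ZpExtension ℚ 2, κ.IsCyclotomic → ∀ v ∈ S, ((2 : ℕ) : 𝓞 ℚ) ∉ v.asIdeal →
      Nat.card (↥(W.localTopPrimary κ (v.adicCompletion ℚ)) ⧸
        W.localTopPrimaryDiv κ (v.adicCompletion ℚ)) ≤ β v)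
    (hlow : ∀ κ : ZpExtension ℚ 2, κ.IsCyclotomic →
      2 ^ a ≤ Nat.card {z : W.selmerLayer κ j // 2 • z = 0})
    (hup : ∀ κ : ZpExtension ℚ 2, κ.IsCyclotomic →
      Nat.card {z : W.selmerLayer κ j' // 2 • z = 0} ≤ 2 ^ d)
    (harith : 2 ^ d * ∏ v ∈ S,
        (if ((2 : ℕ) : 𝓞 ℚ) ∈ v.asIdeal then (2 ^ padicValNat 2 (W.reductionPointCount 2)) ^ 2
          else β v) ^ (if ((2 : ℕ) : 𝓞 ℚ) ∈ v.asIdeal then 1 else 2 ^ j') <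
      2 ^ (2 ^ j' - 2 ^ j + a))
    (hlan : AnalyticLambdaEq W 2 n) (hμan : AnalyticMuLE W 2 0) :
    MainConjectureLowerDivisibilityAtTwoOrd W :=
  katoHalfAt_two_of_towerGap_of_layerSelmer W h17 h414 hper₀ hgo htors
    (towerGapAtTwo_of_layerSelmer_of_greenberg W h33g h33 h34 hgo htors hjj' S hS β hβ hlow hup harith)
    hrank hlan hμan

end Curve

end Summit.BirchSwinnertonDyer.BirchSwinnertonDyer.Theorems.KatoHalfPinch

end
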